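import Mathlib.NumberTheory.NumberField.Basic
import Mathlib.RingTheory.DedekindDomain.AdicValuation
import Mathlib.RingTheory.Ideal.Norm.AbsNorm
import Mathlib.LinearAlgebra.Matrix.Charpoly.Coeff
import HarnessLib

/-!
# Twisting elements `α ≡ 1 (mod 𝔞)` with prescribed `v`-adic distance `α − 1 ∈ 𝔭_vⁿ ∖ 𝔭_v^{n+1}`, and
# `N(α) ≡ 1 (mod d)` for `α ≡ 1 (mod d)` — the choice of `𝔞 = (α)` in de Shalit II.4.12 at `p = 2`

De Shalit II.4.12 (p. 66–67) divides the pseudo-measures `μ_𝔞 = (σ_𝔞 − N𝔞)·μ` by choosing integral ideals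
`𝔞` prime to `6𝔣p`; at `p = 2` (II.4.17 p. 77–78: the group `1 + 4ℤ₂`) the division/gluing argument formalised
in the tree (`GroupDistribution.exists_twisting_μ_eq_of_cocycle_natCast`, p704309; the glue p729700) needs a
principal `𝔞 = (α)` with `α ≡ 1 (mod 𝔣)` whose Artin symbol topologically GENERATES the level-`s` subgroup of
the `𝔭`-adic tower — i.e. `α − 1 ∈ 𝔭^{s+1} ∖ 𝔭^{s+2}` (`hgen_artin`, `RayClassFieldAdicCharacterDivision.lean`) —
and `N𝔞 ≡ 1 (mod 4)` (`h4`). This file supplies the two elementary existence/congruence facts: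

* ★ `exists_sub_one_mem_and_mem_pow_not_mem_pow_succ` — for `𝔞` with `𝔭_v ∤ 𝔞` and every `n`:
  **`∃ α ∈ 𝓞_K, α ≡ 1 (mod 𝔞), α − 1 ∈ 𝔭_vⁿ ∖ 𝔭_v^{n+1}`** (Chinese remainder theorem with a uniformiser);
* ★ `Int.dvd_norm_sub_one_of_sub_one_mem_span` — **`α ≡ 1 (mod d𝓞_K) ⟹ d ∣ N_{K/ℚ}(α) − 1`** (`d ∈ ℤ`; the
  regular representation: `N(1 + d a) = det(1 + d·M_a) ≡ 1 (mod d)`, `Matrix.det_one_add_smul`), and the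
  `absNorm` reading `Ideal.absNorm (α) ≡ 1 (mod d)` when `N(α) > 0`.

Theorems only; no `sorry`.

## References
* [deShalit1987] E. de Shalit, *Iwasawa theory of elliptic curves with complex multiplication* (1987),
  II.4.12 (p. 66–67), II.4.17 (p. 77–78).
* [NeukirchANT1999] J. Neukirch, *Algebraic Number Theory* (1999), Ch. I §3 Thm. (3.6) (CRT), Ch. I §2 (2.6).
-/

noncomputable section

open NumberField IsDedekindDomain

namespace Literature.NumberTheory.NumberFields

variable {K : Type} [Field K] [NumberField K]

/-! ### §1. `α ≡ 1 (mod 𝔞)` with `α − 1 ∈ 𝔭ⁿ ∖ 𝔭^{n+1}` -/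

/-- A uniformiser power: `ϖⁿ ∈ 𝔭ⁿ ∖ 𝔭^{n+1}`. [cite: NeukirchANT1999, Ch. I §11 (11.5)] -/
theorem exists_mem_pow_not_mem_pow_succ (v : HeightOneSpectrum (𝓞 K)) (n : ℕ) :
    ∃ ϖ : 𝓞 K, ϖ ∈ v.asIdeal ^ n ∧ ϖ ∉ v.asIdeal ^ (n + 1) := by
  obtain ⟨π, hπ⟩ := v.intValuation_exists_uniformizer
  refine ⟨π ^ n, ?_, ?_⟩
  · rw [← v.intValuation_le_pow_iff_mem, map_pow, hπ, ← WithZero.exp_nsmul]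
    simp
  · rw [← v.intValuation_le_pow_iff_mem, map_pow, hπ, ← WithZero.exp_nsmul, WithZero.exp_le_exp]
    simp

/-- `𝔞 + 𝔭^k = 𝓞_K` when `𝔭 ∤ 𝔞`. [cite: NeukirchANT1999, Ch. I §3 Thm. (3.6)] -/
theorem sup_pow_eq_top_of_not_le {𝔞 : Ideal (𝓞 K)} {v : HeightOneSpectrum (𝓞 K)}
    (h𝔞v : ¬ 𝔞 ≤ v.asIdeal) (k : ℕ) : 𝔞 ⊔ v.asIdeal ^ k = ⊤ := by
  refine Ideal.sup_pow_eq_top ?_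
  by_contra hne
  have heq : v.asIdeal = 𝔞 ⊔ v.asIdeal := v.isMaximal.eq_of_le hne le_sup_right
  exact h𝔞v (heq.symm ▸ le_sup_left)

/-- ★ **Twisting elements**: for an ideal `𝔞` with `𝔭_v ∤ 𝔞` and every `n` there is `α ∈ 𝓞_K` with
`α ≡ 1 (mod 𝔞)` and `α − 1 ∈ 𝔭_vⁿ ∖ 𝔭_v^{n+1}` (CRT: `α = 1 + ϖⁿ i` with `i ∈ 𝔞`, `i ≡ 1 (mod 𝔭^{n+1})`). At
`p = 2`, `n = s + 1 ≥ 2`, the Artin symbol of `(α)` topologically generates `Gal(K(𝔞𝔭^∞)/K(𝔞𝔭^{s}))`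
(de Shalit II.4.12 / II.4.17: the choice of `𝔞`). [cite: deShalit1987, II.4.12 (p. 66–67), II.4.17 (p. 77–78)]
[cite: NeukirchANT1999, Ch. I §3 Thm. (3.6)] -/
theorem exists_sub_one_mem_and_mem_pow_not_mem_pow_succ {𝔞 : Ideal (𝓞 K)} {v : HeightOneSpectrum (𝓞 K)}
    (h𝔞v : ¬ 𝔞 ≤ v.asIdeal) (n : ℕ) :
    ∃ α : 𝓞 K, α - 1 ∈ 𝔞 ∧ α - 1 ∈ v.asIdeal ^ n ∧ α - 1 ∉ v.asIdeal ^ (n + 1) := by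
  obtain ⟨ϖ, hϖn, hϖn1⟩ := exists_mem_pow_not_mem_pow_succ v n
  have htop := sup_pow_eq_top_of_not_le h𝔞v (n + 1)
  obtain ⟨i, hi, j, hj, hij⟩ := Submodule.mem_sup.mp ((Ideal.eq_top_iff_one _).mp htop)
  refine ⟨1 + ϖ * i, ?_, ?_, ?_⟩
  · rw [add_sub_cancel_left]
    exact 𝔞.mul_mem_left ϖ hi
  · rw [add_sub_cancel_left]
    exact Ideal.mul_mem_right i _ hϖn
  · rw [add_sub_cancel_left]
    intro h
    have hi' : i = 1 - j := by rw [← hij, add_sub_cancel_right]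
    rw [hi', mul_sub, mul_one] at h
    have h' := Ideal.add_mem _ h (Ideal.mul_mem_left _ ϖ hj)
    rw [sub_add_cancel] at h'
    exact hϖn1 h'

/-- With the two side conditions used downstream: `α ∉ 𝔭_v` (when `n ≥ 1`) and `α ≠ 0`.
[cite: deShalit1987, II.4.12 (p. 66–67)] -/
theorem exists_sub_one_mem_and_mem_pow_not_mem_pow_succ' {𝔞 : Ideal (𝓞 K)} {v : HeightOneSpectrum (𝓞 K)}
    (h𝔞v : ¬ 𝔞 ≤ v.asIdeal) (n : ℕ) (hn : 1 ≤ n) :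
    ∃ α : 𝓞 K, α ≠ 0 ∧ α ∉ v.asIdeal ∧ α - 1 ∈ 𝔞 ∧ α - 1 ∈ v.asIdeal ^ n ∧
      α - 1 ∉ v.asIdeal ^ (n + 1) := by
  obtain ⟨α, h𝔞, hn', hn1⟩ := exists_sub_one_mem_and_mem_pow_not_mem_pow_succ h𝔞v n
  have hv1 : α - 1 ∈ v.asIdeal := Ideal.pow_le_self (by omega) hn'
  have hαv : α ∉ v.asIdeal := fun h ↦ v.isPrime.ne_top ((Ideal.eq_top_iff_one _).mpr (by
    have := v.asIdeal.sub_mem h hv1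
    rwa [sub_sub_cancel] at this))
  refine ⟨α, fun h0 ↦ hαv (h0 ▸ v.asIdeal.zero_mem), hαv, h𝔞, hn', hn1⟩

/-! ### §2. `α ≡ 1 (mod d)` ⟹ `N(α) ≡ 1 (mod d)` -/

/-- ★ **`α ≡ 1 (mod d𝓞_K)` ⟹ `d ∣ N_{K/ℚ}(α) − 1`** (`d ∈ ℤ`): in the regular representation on an integral
basis, `N(1 + d·a) = det(1 + d·M_a) = 1 + d·(tr M_a + d·(…))`. At `d = 4` this is the congruence
`N𝔞 ≡ 1 (mod 4)` of de Shalit's twisting ideals at `p = 2`. [cite: NeukirchANT1999, Ch. I §2 (2.6)]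
[cite: deShalit1987, II.4.17 (p. 77–78)] -/
theorem Int.dvd_norm_sub_one_of_sub_one_mem_span (d : ℤ) {α : 𝓞 K}
    (h : α - 1 ∈ Ideal.span {(d : 𝓞 K)}) : d ∣ Algebra.norm ℤ α - 1 := by
  classical
  obtain ⟨a, ha⟩ := Ideal.mem_span_singleton'.mp h
  have hα : α = 1 + d • a := by
    rw [zsmul_eq_mul, mul_comm, ha]; ring
  set b := RingOfIntegers.basis K with hb
  rw [Algebra.norm_eq_matrix_det b, hα, map_add, map_one, map_zsmul, Matrix.det_one_add_smul, add_assoc,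
    add_sub_cancel_left]
  exact Dvd.dvd.add (dvd_mul_left d _) (dvd_mul_of_dvd_right (dvd_pow_self d two_ne_zero) _)

/-- The `absNorm` reading: if moreover `N_{K/ℚ}(α) > 0` (e.g. `K` imaginary quadratic), then
`Ideal.absNorm (α) ≡ 1 (mod d)` as integers. [cite: NeukirchANT1999, Ch. I §2 (2.6)] -/
theorem Int.dvd_absNorm_span_singleton_sub_one (d : ℤ) {α : 𝓞 K}
    (h : α - 1 ∈ Ideal.span {(d : 𝓞 K)}) (hpos : 0 < Algebra.norm ℤ α) :
    d ∣ (Ideal.absNorm (Ideal.span {α}) : ℤ) - 1 := by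
  rw [Ideal.absNorm_span_singleton, Int.natCast_natAbs, abs_of_pos hpos]
  exact Int.dvd_norm_sub_one_of_sub_one_mem_span d h

/-- `α ≡ 1 (mod 𝔭ⁿ)` and `α ≡ 1 (mod 𝔮ᵐ)` with `𝔭ⁿ𝔮ᵐ ∣ (d)`-type packaging: if `α − 1 ∈ 𝔟` and
`(d) ∣ 𝔟` (i.e. `𝔟 ≤ (d)`), then `d ∣ N(α) − 1`. [cite: NeukirchANT1999, Ch. I §2 (2.6)] -/
theorem Int.dvd_norm_sub_one_of_sub_one_mem_of_le (d : ℤ) {𝔟 : Ideal (𝓞 K)}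
    (h𝔟 : 𝔟 ≤ Ideal.span {(d : 𝓞 K)}) {α : 𝓞 K} (h : α - 1 ∈ 𝔟) : d ∣ Algebra.norm ℤ α - 1 :=
  Int.dvd_norm_sub_one_of_sub_one_mem_span d (h𝔟 h)

/-- **Non-units have `absNorm ≥ 2`**: if `α ≠ 0` is not a unit then `2 ≤ Ideal.absNorm (α)` (the bound
`2 ≤ N𝔞` of the division step). [cite: deShalit1987, II.4.12 (p. 66–67)] -/
theorem two_le_absNorm_span_singleton {α : 𝓞 K} (h0 : α ≠ 0) (hu : ¬ IsUnit α) :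
    2 ≤ Ideal.absNorm (Ideal.span {α}) := by
  have h1 : Ideal.absNorm (Ideal.span {α}) ≠ 1 := by
    rw [Ne, Ideal.absNorm_eq_one_iff, Ideal.span_singleton_eq_top]
    exact hu
  have h2 : Ideal.absNorm (Ideal.span {α}) ≠ 0 := by
    rw [Ne, Ideal.absNorm_eq_zero_iff, Ideal.span_singleton_eq_bot]
    exact h0
  omega

end Literature.NumberTheory.NumberFields

end
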